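import Mathlib.CategoryTheory.Groupoid
import Mathlib.CategoryTheory.Endomorphism
import Mathlib.CategoryTheory.Functor.Basic
import Mathlib.Algebra.Group.Subgroup.Ker
import Mathlib.Algebra.Group.Pi.Lemmas
import Literature.IUT.HodgeTheaters.LabelsPlusMinusTorsors
import Literature.IUT.HodgeTheaters.Labels

/-!
# [IUTchI] §6, Definition 6.1 (ii)–(vii): the base (`𝒟`-) interface of the `Θ^{±ell}` theory

Mochizuki, *Inter-universal Teichmüller theory I*, §6, Definition 6.1 (ii)–(vii), kurims manuscript
(May 2020) pp. 156–159 ([IUTchI] Def 6.1 (ii)-(vii) pp.156-159) [claim: Mochizuki2012, status: disputed].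

Items (ii), (iii), (v), (vi), (vii) of Def 6.1 are not definitions over elementary data: they are
*reconstruction statements* ("`π₁(†𝒟_v)` determines, in a functorial fashion, …", "it makes sense to
speak of the set of cusps of `†𝒟_v`", "one may construct, in a category-theoretic fashion from
`𝒟^{⊚±}`, the outer homomorphism `Aut(𝒟^{⊚±}) → GL₂(𝔽_l)/{±1}`") resting on the tempered / étale
fundamental groups of [IUTchI] §1–§4, [EtTh] §2 and the absolute anabelian algorithms of
[AbsTopI] Lemma 4.5, [AbsTopIII] Thm 1.9, Cor 2.4, 2.8, 2.9. Following the cell's STATEMENTS-FIRST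
rule (deep absent inputs = INTERFACE structures whose axioms quote print), this file packages
exactly the OUTPUT of those items that §6 consumes as one structure `PMBaseKit l`, each field's
docstring quoting the printed sentence it stands for, and then DEFINES over it the notions that
Def 6.1 genuinely defines:

* (iii) positive / negative automorphisms `Aut_+(†𝒟_v) ⊆ Aut(†𝒟_v)` (`PMBaseKit.autPlus`,
  `autMinus`), and (v) `Aut_csp ⊆ Aut_+ ⊆ Aut_± ⊆ Aut(†𝒟^{⊚±})` (`autCsp`, `autPlusG`, `autPMg`);
* `𝒟`-prime-strips, `Aut_+(†𝔇)`, `Aut^α(†𝔇)` and (iv) `+`-full poly-isomorphisms are in the companion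
  file `PMBaseStrips.lean`.

Consistency: a model of the whole kit for every odd prime `l` is constructed in the companion file
`PMBaseKitModel.lean` (two-object "collage" categories at each `v`, the affine group `𝔽_l ⋊ 𝔽_l^×`
as `Aut(𝒟^{⊚±})` with `Aut_± = 𝔽_l ⋊ {±1}`), so no field combination is vacuous; for `l ≤ 2` no kit
exists (`exists_negative` versus chart-compatibility), in accordance with `l ≥ 5` in [IUTchI]
Def 3.1 (c).

Modelling conventions (recorded for the referee; [IUTchI] §0 p. 33 "poly-morphisms",
TODO-merge:abc-iut-L5-t1): at each `v ∈ 𝕍` all objects in play — isomorphs `†𝒟_v` of the model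
`𝒟_v` (a category `ℬ^temp(X_v)⁰` / `ℬ(X→_v)⁰` for `v` nonarchimedean, an Aut-holomorphic orbispace
for `v` archimedean, [IUTchI] Def 4.1 (i) p. 95, TODO-merge:abc-iut-L5-t3) and the global objects
`†𝒟^{⊚±}` seen at `v` — live in ONE ambient Mathlib category `Amb v`; "isomorphism" = Mathlib `Iso`;
a poly-morphism `A → B` is a `Set (A ⟶ B)` / `Set (A ≅ B)`; `Aut(A)` is Mathlib's
`CategoryTheory.Aut A` (so `f * g = g ≫ f`). For archimedean `v` the "morphisms `U → †𝒟^{⊚±}`" of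
Def 6.1 (vii) (morphisms of Aut-holomorphic orbispaces `U → X(†𝒟^{⊚±}, w)` for some `w`) are by
definition the morphisms `U ⟶ atV v †𝒟^{⊚±}` of `Amb v`. The global objects `†𝒟^{⊚±}` ("any
category isomorphic to `𝒟^{⊚±} = ℬ(X_K)⁰`", Def 6.1 (v), (vi)) form a separate category `Glob`
with functors `atV v : Glob ⥤ Amb v`. What is NOT typed here: the identification of `Aut_±(𝒟^{⊚±})`
with the stabiliser of `𝕍^± ⊆ 𝕍(K)` (Def 6.1 (v), last sentence) and Remark 6.1.1 `𝕍^± = 𝕍^{±un}`,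
which need `𝕍(K)` of [IUTchI] Def 3.1 (TODO-merge:abc-iut-L5-t2); the outer homomorphism to
`GL₂(𝔽_l)/{±1}` itself (only its consequences `Aut ↠ 𝔽_l^⋇`, `Aut_±/Aut_csp ≅ 𝔽_l^{⋊±}` are fields).
-/

namespace Literature.IUT.HodgeTheaters

open CategoryTheory

universe u

/-- **The base (`𝒟`-) interface of [IUTchI] §6.** The outputs of [IUTchI] Def 4.1 (i) and Def 6.1
(ii), (iii), (v), (vi), (vii) that the additive combinatorial Teichmüller theory consumes, relative
to a fixed collection of initial Θ-data with prime `l` and set of valuations `𝕍` (≅ `𝕍_mod`,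
[IUTchI] Def 3.1 (e), TODO-merge:abc-iut-L5-t2). Every field quotes the printed sentence it
abstracts. ([IUTchI] Def 6.1 (ii)-(vii) pp.156-159) [claim: Mochizuki2012, status: disputed] -/
structure PMBaseKit (l : ℕ) where
  /-- the finite set `𝕍` of valuations of the initial Θ-data ([IUTchI] Def 3.1 (e) p. 62;
  TODO-merge:abc-iut-L5-t2) -/
  V : Type
  /-- `𝕍` has decidable equality -/
  [decEqV : DecidableEq V]
  /-- `𝕍^bad ⊆ 𝕍` ([IUTchI] Def 3.1 (e), (f)): the valuations of bad (multiplicative) reduction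
  singled out by the initial Θ-data; decidable -/
  bad : Finset V
  /-- `𝕍^arc ⊆ 𝕍`: the archimedean valuations -/
  arc : Finset V
  /-- the ambient category at `v`: for `v ∈ 𝕍^non` categories (temperoids / anabelioids) and
  functors up to isomorphism, for `v ∈ 𝕍^arc` Aut-holomorphic orbispaces ([IUTchI] Def 4.1 (i) p. 95;
  Def 6.1 (vii) p. 159 for morphisms to global objects); TODO-merge:abc-iut-L5-t3 -/
  Amb : V → Type u
  /-- category structure of the ambient category at `v` (a small category) -/
  [catAmb : ∀ v, Category.{u} (Amb v)]
  /-- the model object `𝒟_v` at `v` ([IUTchI] Examples 3.2 (i), 3.3 (i), 3.4 (i): `ℬ^temp(X_v)⁰`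
  for `v ∈ 𝕍^bad`, `ℬ(X→_v)⁰` for `v ∈ 𝕍^good ∩ 𝕍^non`, the Aut-holomorphic orbispace `X→_v` for
  `v ∈ 𝕍^arc`); TODO-merge:abc-iut-L5-t2 -/
  model : ∀ v, Amb v
  /-- `†𝒟_v^±`: "`π₁(†𝒟_v)` determines, in a functorial fashion, a topological [in fact, profinite if
  `v ∈ 𝕍^good`] group corresponding to `X_v` [cf. Corollary 1.2 if `v ∈ 𝕍^good`; [EtTh], Proposition
  2.4, if `v ∈ 𝕍^bad`], which contains `π₁(†𝒟_v)` as an open subgroup; thus, if we write `†𝒟_v^±`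
  for `ℬ(−)⁰` of this topological group …" / for `v ∈ 𝕍^arc` "an Aut-holomorphic orbispace `†𝒟_v^±`
  corresponding to `X_v`" ([IUTchI] Def 6.1 (ii) p. 156) -/
  pmObj : ∀ v, Amb v → Amb v
  /-- "… then we obtain a natural morphism `†𝒟_v → †𝒟_v^±`" ([IUTchI] Def 6.1 (ii) p. 156) -/
  toPM : ∀ v (X : Amb v), X ⟶ pmObj v X
  /-- `LabCusp^±(†𝒟_v)`, "the set of ±-label classes of cusps of `†𝒟_v`" ([IUTchI] Def 6.1 (iii)
  p. 156: "it makes sense to speak of the set of cusps of `†𝒟_v` … we define a ±-label class of cusps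
  of `†𝒟_v` to be the set of cusps of `†𝒟_v` that lie over a single cusp of `†𝒟_v^±`", the latter
  being the object "corresponding to `X_v`" of Def 6.1 (ii) p. 156) -/
  LabCuspPM : ∀ v, Amb v → Type u
  /-- "`LabCusp^±(†𝒟_v)` is equipped with a natural `𝔽_l^±`-group structure" ([IUTchI] Def 6.1 (iii)
  p. 157: "we obtain a natural bijection `LabCusp^±(†𝒟_v) ⥲ 𝔽_l` — which is well-defined up to
  multiplication by `±1`"), for every isomorph `†𝒟_v` of `𝒟_v` -/
  labPM : ∀ v (X : Amb v), Nonempty (X ≅ model v) → FlPMGroup l (LabCuspPM v X)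
  /-- functoriality of `LabCusp^±(−)` in isomorphisms `†𝒟_v ⥲ ‡𝒟_v` ("may be constructed solely from
  `†𝒟_v`", [IUTchI] Def 6.1 (iii) p. 156) -/
  labMap : ∀ v {X Y : Amb v}, (X ≅ Y) → (LabCuspPM v X ≃ LabCuspPM v Y)
  /-- `LabCusp^±` of the identity is the identity -/
  labMap_refl : ∀ v (X : Amb v), labMap v (Iso.refl X) = Equiv.refl _
  /-- `LabCusp^±` of a composite is the composite -/
  labMap_trans : ∀ v {X Y Z : Amb v} (φ : X ≅ Y) (ψ : Y ≅ Z),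
    labMap v (φ ≪≫ ψ) = (labMap v φ).trans (labMap v ψ)
  /-- induced bijections are compatible with the `𝔽_l^±`-group structures (naturality of the
  structure of [IUTchI] Def 6.1 (iii)): charts pull back to charts -/
  labMap_charts : ∀ v {X Y : Amb v} (hX : Nonempty (X ≅ model v)) (hY : Nonempty (Y ≅ model v))
    (φ : X ≅ Y), ∀ e ∈ (labPM v Y hY).charts, (labMap v φ).trans e ∈ (labPM v X hX).charts
  /-- "this `𝔽_l^±`-group structure determines a natural surjection `Aut(†𝒟_v) ↠ {±1}` — i.e., by
  considering the induced automorphism of `LabCusp^±(†𝒟_v)`" ([IUTchI] Def 6.1 (iii) p. 157):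
  surjectivity = some automorphism acts nontrivially on `±`-label classes -/
  exists_negative : ∀ v (X : Amb v), Nonempty (X ≅ model v) →
    ∃ α : Aut X, labMap v α ≠ Equiv.refl _
  /-- the category of global objects: isomorphs `†𝒟^{⊚±}` of `𝒟^{⊚±} := ℬ(X_K)⁰` ([IUTchI] Def 6.1
  (v) p. 158, (vi) p. 159 "any category isomorphic to `𝒟^{⊚±}`") and their isomorphisms in the
  sense of §0 -/
  Glob : Type u
  /-- category structure on global objects (a small category) -/
  [catGlob : Category.{u} Glob]
  /-- the model global object `𝒟^{⊚±} = ℬ(X_K)⁰` ([IUTchI] Def 6.1 (v) p. 158) -/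
  gModel : Glob
  /-- every global object is an isomorph of `𝒟^{⊚±}` -/
  gIso : ∀ G : Glob, Nonempty (G ≅ gModel)
  /-- `LabCusp^±(†𝒟^{⊚±})`, "the set of ±-label classes of cusps — which, in this case, may be
  identified with the set of cusps of `†𝒟^{⊚±}`" ([IUTchI] Def 6.1 (vi) p. 159) -/
  GLab : Glob → Type u
  /-- functoriality of `LabCusp^±(†𝒟^{⊚±})` (= the set of cusps, Def 6.1 (vi)) in isomorphisms -/
  gLabMap : ∀ {G H : Glob}, (G ≅ H) → (GLab G ≃ GLab H)
  /-- functoriality: identity -/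
  gLabMap_refl : ∀ G, gLabMap (Iso.refl G) = Equiv.refl _
  /-- functoriality: composites -/
  gLabMap_trans : ∀ {G H K : Glob} (φ : G ≅ H) (ψ : H ≅ K),
    gLabMap (φ ≪≫ ψ) = (gLabMap φ).trans (gLabMap ψ)
  /-- "the natural surjective homomorphism `Aut(𝒟^{⊚±}) ↠ 𝔽_l^⋇` [which may be reconstructed
  category-theoretically from `𝒟^{⊚±}`!]" determined by the rank one quotient of `Δ_X^{ab} ⊗ 𝔽_l`
  ([IUTchI] Def 6.1 (v) p. 158), for every isomorph; `𝔽_l^⋇ = 𝔽_l^×/{±1}` is abc-iut-L5-t3's `FlStar`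
  (`Labels.lean`); its kernel is `Aut_±(†𝒟^{⊚±})` (`PMBaseKit.autPMg` below) -/
  toFlStar : ∀ G : Glob, Aut G →* FlStar l
  /-- the homomorphism to `𝔽_l^⋇` is surjective -/
  toFlStar_surjective : ∀ G, Function.Surjective (toFlStar G)
  /-- "the cusp `ε` determines … a natural `𝔽_l^±`-torsor structure on the set `LabCusp^±(𝒟^{⊚±})`"
  ([IUTchI] Def 6.1 (v) p. 158) — on the MODEL `𝒟^{⊚±}`; an isomorph `†𝒟^{⊚±}` acquires one by
  transport along an isomorphism `𝒟^{⊚±} ⥲ †𝒟^{⊚±}`, well-defined exactly up to `Aut_±`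
  (`PMBaseKit.gLabTOf`; cf. Prop 6.5 (iv)) -/
  gLabT : FlPMTorsor l (GLab gModel)
  /-- the isomorphism of `𝔽_l^±`-torsors `LabCusp^±(𝒟^{⊚±}) ⥲ 𝔽_l` FIXED in [IUTchI] Example 6.3 (i)
  p. 160 ("let us fix an isomorphism of `𝔽_l^±`-torsors … which we shall use to identify
  `LabCusp^±(𝒟^{⊚±})` with `𝔽_l`"): a chart of the torsor structure of the model -/
  gChart₀ : GLab gModel ≃ ZMod l
  /-- the fixed identification is one of the torsor's charts -/
  gChart₀_mem : gChart₀ ∈ gLabT.charts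
  /-- `Aut_csp(†𝒟^{⊚±}) ⊆ Aut_±(†𝒟^{⊚±})`, "the subgroup [which may be reconstructed
  category-theoretically from `𝒟^{⊚±}`!] of automorphisms that fix the cusps of `X_K`" ([IUTchI]
  Def 6.1 (v) p. 158; the cusps "may be identified with" `LabCusp^±`, Def 6.1 (vi) p. 159). Print
  DEFINES `Aut_csp` as a subgroup of `Aut_±`; we render `Aut_csp` as the automorphisms acting
  trivially on `LabCusp^±` and record here — a mild strengthening that holds for `X_K` (an
  automorphism fixing all cusps acts trivially on the rank-one quotient) — that these lie in
  `Aut_±`, i.e. map to `1 ∈ 𝔽_l^⋇` -/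
  autCsp_le : ∀ G, ∀ α : Aut G, gLabMap α = Equiv.refl _ → toFlStar G α = 1
  /-- "one obtains natural outer isomorphisms `Aut_K(X_K) ⥲ Aut_±(𝒟^{⊚±})/Aut_csp(𝒟^{⊚±}) ⥲ 𝔽_l^{⋊±}`"
  ([IUTchI] Def 6.1 (v) p. 158) and "the natural bijection `Aut_±(†𝒟^{⊚±})/Aut_csp(†𝒟^{⊚±}) ⥲
  Aut_±(LabCusp^±(†𝒟^{⊚±}))` determined by the tautological action" (Prop 6.5 (iv) p. 165): on the
  model, the image of `Aut_±(𝒟^{⊚±})` in the permutations of `LabCusp^±(𝒟^{⊚±})` is `Aut_±` of the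
  torsor -/
  gLab_range : ∀ σ : Equiv.Perm (GLab gModel),
    σ ∈ gLabT.autPM ↔ ∃ α : Aut gModel, toFlStar gModel α = 1 ∧ gLabMap α = σ
  /-- the global object seen at `v`: the functor `Glob ⥤ Amb v` through which "morphisms
  `†𝒟_v → †𝒟^{⊚±}`" are morphisms of `Amb v` (for `v ∈ 𝕍^arc` this is [IUTchI] Def 6.1 (vii) p. 159:
  "we define a morphism `U → †𝒟^{⊚±}` to be a morphism of Aut-holomorphic orbispaces
  `U → X(†𝒟^{⊚±}, w)` for some `w ∈ 𝕍(†𝒟^{⊚±})^arc`"; for `v ∈ 𝕍^non` the natural restriction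
  functors of finite étale coverings, Example 6.3 (i) p. 161) -/
  atV : ∀ v, Glob ⥤ Amb v
  /-- the natural morphism `φ^{Θell}_{•,v} : 𝒟_v → 𝒟^{⊚±}` "determined by the natural composite
  morphism `X→_v → X_v → X_K` (resp. `X_v → X_v → X_K`)" for `v ∈ 𝕍^non`, "the tautological morphism
  `𝒟_v = X→_v → X_v ⥲ X(𝒟^{⊚±}, v)`" for `v ∈ 𝕍^arc` ([IUTchI] Example 6.3 (i) p. 161) -/
  phiEll : ∀ v, model v ⟶ (atV v).obj gModel
  /-- the map on `±`-label classes of cusps induced by a morphism `†𝒟_v → †𝒟^{⊚±}` (cusps of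
  `X_v` map to cusps of `X_K`; used in [IUTchI] Prop 6.5 (i) p. 163 "the `𝒟-Θ^{ell}`-bridge induces a
  bijection of sets of ±-label classes of cusps") -/
  labOfHom : ∀ v {X : Amb v} {G : Glob}, (X ⟶ (atV v).obj G) → (LabCuspPM v X → GLab G)
  /-- naturality of `labOfHom` in isomorphisms of the source -/
  labOfHom_pre : ∀ v {X Y : Amb v} {G : Glob} (φ : X ≅ Y) (f : Y ⟶ (atV v).obj G),
    labOfHom v (φ.hom ≫ f) = labOfHom v f ∘ labMap v φ
  /-- naturality of `labOfHom` in isomorphisms of the target -/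
  labOfHom_post : ∀ v {X : Amb v} {G H : Glob} (f : X ⟶ (atV v).obj G) (ψ : G ≅ H),
    labOfHom v (f ≫ (atV v).map ψ.hom) = gLabMap ψ ∘ labOfHom v f
  /-- `φ^{Θell}_{•,v}` induces a bijection `LabCusp^±(𝒟_v) ⥲ LabCusp^±(𝒟^{⊚±})` … -/
  labOfHom_phiEll_bijective : ∀ v, Function.Bijective (labOfHom v (phiEll v))
  /-- … "that is compatible with the respective `𝔽_l^±`-torsor structures" ([IUTchI] Prop 6.5 (i)
  p. 163; for the model this is the content of Example 6.3 (i)'s identification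
  `LabCusp^±(𝒟^{⊚±}) ⥲ 𝔽_l`): the `{±1}`-orbit of charts of the `𝔽_l^±`-GROUP `LabCusp^±(𝒟_v)` is
  carried into the `𝔽_l^{⋊±}`-orbit of charts of the `𝔽_l^±`-TORSOR `LabCusp^±(𝒟^{⊚±})` (a group
  structure induces a torsor structure, `FlPMGroup.toTorsor`, not conversely) -/
  labOfHom_phiEll_charts : ∀ v, ∀ e ∈ (labPM v (model v) ⟨Iso.refl _⟩).charts,
    (Equiv.ofBijective _ (labOfHom_phiEll_bijective v)).symm.trans e ∈ gLabT.charts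

attribute [instance] PMBaseKit.decEqV PMBaseKit.catAmb PMBaseKit.catGlob

namespace PMBaseKit

variable {l : ℕ} (K : PMBaseKit.{u} l)

/-- "`†𝒟_v` is a category which admits an equivalence `†𝒟_v ⥲ 𝒟_v`" / "an Aut-holomorphic orbispace
such that there exists an isomorphism `†𝒟_v ⥲ 𝒟_v`" ([IUTchI] Def 4.1 (i) p. 95;
TODO-merge:abc-iut-L5-t3): `X` is an isomorph of the model at `v`.
([IUTchI] Def 4.1 (i) p.95) [claim: Mochizuki2012, status: disputed] -/
def IsLocal (v : K.V) (X : K.Amb v) : Prop := Nonempty (X ≅ K.model v)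

/-- The model `𝒟_v` is an isomorph of itself. ([IUTchI] Def 4.1 (i) p.95) [claim: Mochizuki2012, status: disputed] -/
theorem isLocal_model (v : K.V) : K.IsLocal v (K.model v) := ⟨Iso.refl _⟩

/-- Isomorphs of isomorphs are isomorphs. ([IUTchI] Def 4.1 (i) p.95) [claim: Mochizuki2012, status: disputed] -/
theorem IsLocal.of_iso {v : K.V} {X Y : K.Amb v} (h : K.IsLocal v Y) (φ : X ≅ Y) : K.IsLocal v X :=
  ⟨φ ≪≫ h.some⟩

/-! ### Def 6.1 (iii): positive and negative automorphisms -/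

/-- The action of `Aut(†𝒟_v)` on `LabCusp^±(†𝒟_v)` ("by considering the induced automorphism of
`LabCusp^±(†𝒟_v)`", [IUTchI] Def 6.1 (iii) p. 157), as a homomorphism to the permutation group.
([IUTchI] Def 6.1 (iii) p.157) [claim: Mochizuki2012, status: disputed] -/
def labAct (v : K.V) (X : K.Amb v) : Aut X →* Equiv.Perm (K.LabCuspPM v X) where
  toFun α := K.labMap v α
  map_one' := K.labMap_refl v X
  map_mul' α β := by
    rw [Aut.Aut_mul_def, K.labMap_trans, Equiv.Perm.mul_def]

/-- `labAct` is `labMap`. ([IUTchI] Def 6.1 (iii) p.157) [claim: Mochizuki2012, status: disputed] -/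
@[simp] theorem labAct_apply (v : K.V) (X : K.Amb v) (α : Aut X) : K.labAct v X α = K.labMap v α := rfl

/-- `Aut_+(†𝒟_v) ⊆ Aut(†𝒟_v)`, "the index two subgroup of positive automorphisms [i.e., the kernel of
the above surjection `Aut(†𝒟_v) ↠ {±1}`]" ([IUTchI] Def 6.1 (iii) p. 157): the automorphisms acting
trivially on `LabCusp^±(†𝒟_v)` (for `2 < l` an automorphism compatible with the `𝔽_l^±`-group
structure acts by `+1` or `−1`, and `−1` acts nontrivially).
([IUTchI] Def 6.1 (iii) p.157) [claim: Mochizuki2012, status: disputed] -/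
def autPlus (v : K.V) (X : K.Amb v) : Subgroup (Aut X) := (K.labAct v X).ker

/-- Membership in `Aut_+(†𝒟_v)`: acting as the identity on `±`-label classes of cusps.
([IUTchI] Def 6.1 (iii) p.157) [claim: Mochizuki2012, status: disputed] -/
theorem mem_autPlus_iff {v : K.V} {X : K.Amb v} (α : Aut X) :
    α ∈ K.autPlus v X ↔ K.labMap v α = Equiv.refl _ := MonoidHom.mem_ker

/-- `Aut_−(†𝒟_v) := Aut(†𝒟_v) \ Aut_+(†𝒟_v)`, "the subset of negative automorphisms" ([IUTchI]
Def 6.1 (iii) p. 157). ([IUTchI] Def 6.1 (iii) p.157) [claim: Mochizuki2012, status: disputed] -/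
def autMinus (v : K.V) (X : K.Amb v) : Set (Aut X) := (K.autPlus v X : Set (Aut X))ᶜ

/-- `Aut_+(†𝒟_v)` is a proper subgroup of `Aut(†𝒟_v)` for isomorphs of `𝒟_v`: negative
automorphisms exist ([IUTchI] Def 6.1 (iii) p. 157 "natural surjection `Aut(†𝒟_v) ↠ {±1}`").
([IUTchI] Def 6.1 (iii) p.157) [claim: Mochizuki2012, status: disputed] -/
theorem autMinus_nonempty {v : K.V} {X : K.Amb v} (hX : K.IsLocal v X) : (K.autMinus v X).Nonempty := by
  obtain ⟨α, hα⟩ := K.exists_negative v X hX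
  exact ⟨α, fun h => hα ((K.mem_autPlus_iff α).mp h)⟩

/-! ### Def 6.1 (v): `Aut_csp ⊆ Aut_+ ⊆ Aut_± ⊆ Aut` of a global object -/

/-- `Aut_±(†𝒟^{⊚±}) ⊆ Aut(†𝒟^{⊚±})`: the kernel of "the natural surjective homomorphism
`Aut(𝒟^{⊚±}) ↠ 𝔽_l^⋇` … whose kernel we denote by `Aut_±(𝒟^{⊚±})`" ([IUTchI] Def 6.1 (v) p. 158).
([IUTchI] Def 6.1 (v) p.158) [claim: Mochizuki2012, status: disputed] -/
def autPMg (G : K.Glob) : Subgroup (Aut G) := (K.toFlStar G).ker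

/-- Membership in `Aut_±(†𝒟^{⊚±})`: trivial image in `𝔽_l^⋇`. ([IUTchI] Def 6.1 (v) p.158) [claim: Mochizuki2012, status: disputed] -/
theorem mem_autPMg_iff {G : K.Glob} (α : Aut G) : α ∈ K.autPMg G ↔ K.toFlStar G α = 1 := MonoidHom.mem_ker

/-- `Aut_±(†𝒟^{⊚±})` is a normal subgroup (a kernel). ([IUTchI] Def 6.1 (v) p.158) [claim: Mochizuki2012, status: disputed] -/
instance autPMg_normal (G : K.Glob) : (K.autPMg G).Normal := MonoidHom.normal_ker _

/-- `Aut(†𝒟^{⊚±})/Aut_±(†𝒟^{⊚±}) ≅ 𝔽_l^⋇` has cardinality `l^⋇ = (l − 1)/2` for a prime `l ≠ 2`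
([IUTchI] Def 6.1 (v) p. 158; `l^⋇` of §4 p. 95). PROVED from surjectivity and abc-iut-L5-t3's
`card_flStar`. ([IUTchI] Def 6.1 (v) p.158) [claim: Mochizuki2012, status: disputed] -/
theorem index_autPMg [Fact l.Prime] (hl : l ≠ 2) (G : K.Glob) : (K.autPMg G).index = lStar l := by
  rw [autPMg, Subgroup.index_ker, MonoidHom.range_eq_top.mpr (K.toFlStar_surjective G),
    Subgroup.card_top, card_flStar l hl]

/-- The tautological action of `Aut(†𝒟^{⊚±})` on `LabCusp^±(†𝒟^{⊚±})` ([IUTchI] Def 6.1 (v) p. 158;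
Prop 6.5 (iv) p. 165 "the tautological action of `Aut_±(†𝒟^{⊚±})/Aut_csp(†𝒟^{⊚±})` on the set of
±-label classes of cusps"). ([IUTchI] Def 6.1 (v) p.158) [claim: Mochizuki2012, status: disputed] -/
def gLabAct (G : K.Glob) : Aut G →* Equiv.Perm (K.GLab G) where
  toFun α := K.gLabMap α
  map_one' := K.gLabMap_refl G
  map_mul' α β := by
    rw [Aut.Aut_mul_def, K.gLabMap_trans, Equiv.Perm.mul_def]

/-- `Aut_csp(†𝒟^{⊚±})`: "the subgroup … of automorphisms that fix the cusps of `X_K`" ([IUTchI] Def 6.1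
(v) p. 158), i.e. acting trivially on `LabCusp^±(†𝒟^{⊚±})` (= the cusps, Def 6.1 (vi)).
([IUTchI] Def 6.1 (v) p.158) [claim: Mochizuki2012, status: disputed] -/
def autCsp (G : K.Glob) : Subgroup (Aut G) := (K.gLabAct G).ker

/-- `Aut_csp(†𝒟^{⊚±}) ⊆ Aut_±(†𝒟^{⊚±})` ([IUTchI] Def 6.1 (v) p. 158).
([IUTchI] Def 6.1 (v) p.158) [claim: Mochizuki2012, status: disputed] -/
theorem autCsp_le_autPMg (G : K.Glob) : K.autCsp G ≤ K.autPMg G :=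
  fun α hα => (K.mem_autPMg_iff α).mpr (K.autCsp_le G α (MonoidHom.mem_ker.mp hα))

/-- `Aut_+(𝒟^{⊚±}) ⊆ Aut_±(𝒟^{⊚±})`, "the unique index two subgroup containing `Aut_csp(𝒟^{⊚±})`", on
which "the cusp `ε` determines a natural `𝔽_l^±`-group structure" ([IUTchI] Def 6.1 (v) p. 158): for
the model, the elements of `Aut_±` acting on `LabCusp^±(𝒟^{⊚±})` by positive automorphisms `Aut_+` of
the torsor. ([IUTchI] Def 6.1 (v) p.158) [claim: Mochizuki2012, status: disputed] -/
def autPlusG : Subgroup (Aut K.gModel) :=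
  K.autPMg K.gModel ⊓ K.gLabT.autPlus.comap (K.gLabAct K.gModel)

/-- `Aut_csp ⊆ Aut_+` for the model global object. ([IUTchI] Def 6.1 (v) p.158) [claim: Mochizuki2012, status: disputed] -/
theorem autCsp_le_autPlusG : K.autCsp K.gModel ≤ K.autPlusG := by
  intro α hα
  rw [autPlusG, Subgroup.mem_inf, Subgroup.mem_comap]
  refine ⟨K.autCsp_le_autPMg _ hα, ?_⟩
  rw [MonoidHom.mem_ker.mp hα]
  exact one_mem _

/-- `Aut_+ ⊆ Aut_±` for the model global object. ([IUTchI] Def 6.1 (v) p.158) [claim: Mochizuki2012, status: disputed] -/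
theorem autPlusG_le_autPMg : K.autPlusG ≤ K.autPMg K.gModel :=
  fun _ h => (Subgroup.mem_inf.mp h).1

/-- The `𝔽_l^±`-torsor structure on `LabCusp^±(†𝒟^{⊚±})` of an isomorph, TRANSPORTED from the model along
an isomorphism `β : 𝒟^{⊚±} ⥲ †𝒟^{⊚±}` ([IUTchI] Def 6.1 (v), (vi) pp. 158–159): a bijection
`LabCusp^±(†𝒟^{⊚±}) ⥲ 𝔽_l` is a chart iff its composite with `LabCusp^±(β)` is a chart of the model.
Replacing `β` by `β ∘ α` with `α ∈ Aut_±(𝒟^{⊚±})` does not change it (`gLab_range`).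
([IUTchI] Def 6.1 (vi) p.159) [claim: Mochizuki2012, status: disputed] -/
def gLabTOf {G : K.Glob} (β : K.gModel ≅ G) : FlPMTorsor l (K.GLab G) where
  charts := {e | (K.gLabMap β).trans e ∈ K.gLabT.charts}
  nonempty := ⟨(K.gLabMap β).symm.trans K.gChart₀, by
    simpa only [Set.mem_setOf_eq, ← Equiv.trans_assoc, Equiv.self_trans_symm, Equiv.refl_trans]
      using K.gChart₀_mem⟩
  eq_orbit := by
    intro e he
    ext e'
    simp only [Set.mem_setOf_eq, Set.mem_range]
    rw [K.gLabT.eq_orbit _ he]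
    constructor
    · rintro ⟨g, hg⟩
      exact ⟨g, by
        have := congrArg (fun f => (K.gLabMap β).symm.trans f) hg
        simpa only [← Equiv.trans_assoc, Equiv.symm_trans_self, Equiv.refl_trans] using this⟩
    · rintro ⟨g, rfl⟩
      exact ⟨g, Equiv.trans_assoc _ _ _⟩

end PMBaseKit

end Literature.IUT.HodgeTheaters
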